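import Summits.Ventures.PercRepro.S2ElevenEightK2NuFourThirteen
import Summits.Ventures.PercRepro.S2ElevenEightK2NuFourTwelve
import Summits.Ventures.PercRepro.S2ElevenEightK2NuFourEleven
import Summits.Ventures.PercRepro.S2ElevenEightK2NuFourSimpleNine
import Summits.Ventures.PercRepro.S2ElevenEightK2NuFourSimpleEight

/-!
# PercRepro — S2: THE CASE `ν = 4` OF THE CELL `(11, 8)` — THE ASSEMBLY (p7, gen 18; sub-claim S2)

The case `ν = 4` of the twice-scaled cell `(11, 8)` of `(13, 8)` at `K₂ = 12107` (coloops allowed) (a set of nullity `4` on `≤ 9` points, none of nullity `5` on `≤ 10`, `6` on `≤ 11`,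
`7` on `≤ 12`) splits by the largest set of rank `6`: (I) a set of nullity `7` on `≤ 13` points (S2ElevenEightK2NuFourThirteen, the kit's
hitting counts); (II) none, but a set of nullity `6` on `≤ 12` (S2ElevenEightK2NuFourTwelve, the exact-rank lever with a nullity-`2`
contraction); (III) none, but a set of nullity `5` on `≤ 11` (S2ElevenEightK2NuFourEleven, the counts of a coloop-free nullity-`3`
contraction through one deletion); (IV) none — then the nullity-`4` flat `W` has `8` or `9` points (lines have `≤ 3`, planes `≤ 6` points)
and its contraction is simple (S2ElevenEightK2NuFourSimpleNine / SimpleEight). **`c025_eleven_eight_k2_nu_four`** — exactly the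
hypothesis `hnu4₁₁` of `c025_core_five_thirteen_eight_of_nu_four`. Nothing about the cell is claimed. Axioms: standard.
-/

open scoped Matroid

namespace PercRepro

namespace ThmN

open Set

variable {α : Type}

/-- **The case `ν = 4` of the twice-scaled cell `(11, 8)` of `(13, 8)` at `K₂ = 12107` (coloops allowed)**: the four parts by the largest rank-`6` set. -/
theorem c025_eleven_eight_k2_nu_four (M : Matroid α) [M.Finite]
    (hR : M.eRank = ((11 : ℕ) : ℕ∞)) (hn : M.E.ncard = 11 + 8)
    (hfree : ∀ e ∈ M.E, ∃ A ⊆ M.E \ {e}, e ∉ M.closure A ∧ e ∉ M.closure ((M.E \ {e}) \ A))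
    (_h7 : ¬ ∃ W ⊆ M.E, W.ncard ≤ 12 ∧ W.encard = M.eRk W + 7) (_h6 : ¬ ∃ W ⊆ M.E, W.ncard ≤ 11 ∧ W.encard = M.eRk W + 6)
    (h5 : ¬ ∃ W ⊆ M.E, W.ncard ≤ 10 ∧ W.encard = M.eRk W + 5) (h4 : ∃ W ⊆ M.E, W.ncard ≤ 9 ∧ W.encard = M.eRk W + 4) :
    ((phiK 13 5 - 6) / 4) * (Matroid.topCount M 11 5 : ℚ) ≤ (Matroid.midCount M 11 5 : ℚ) := by
  classical
  by_cases hV13 : ∃ V ⊆ M.E, V.ncard ≤ 13 ∧ V.encard = M.eRk V + 7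
  · exact c025_eleven_eight_k2_nu_four_thirteen M hR hn hfree h5 hV13
  by_cases hV12 : ∃ V ⊆ M.E, V.ncard ≤ 12 ∧ V.encard = M.eRk V + 6
  · exact c025_eleven_eight_k2_nu_four_twelve M hR hn hfree h5 hV13 hV12
  by_cases hV11 : ∃ V ⊆ M.E, V.ncard ≤ 11 ∧ V.encard = M.eRk V + 5
  · exact c025_eleven_eight_k2_nu_four_eleven M hR hn hfree h5 hV12 hV11
  -- part (IV): the nullity-`4` flat has `8` or `9` points
  obtain ⟨W, hW, hWn, hWk⟩ := h4
  have hs : ∀ e ∈ M.E, ∀ f ∈ M.E, e ≠ f → M.eRk {e, f} = 2 := by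
    intro e he f hf hef
    have h2 : (2 : ℕ∞) ≤ M.eRk {e, f} :=
      two_le_eRk_of_two_le_ncard_of_free M hfree (pair_subset he hf) (by rw [ncard_pair hef])
    have h3 : M.eRk {e, f} ≤ 2 := by
      have := M.eRk_le_encard {e, f}
      rwa [encard_pair hef] at this
    exact le_antisymm h3 h2
  have hC1 : ∀ L ⊆ M.E, M.eRk L = 2 → L.ncard ≤ 3 :=
    fun L hL hr => ncard_le_three_of_eRk_two M hs hfree hL hr
  have hWfin : W.Finite := M.ground_finite.subset hW
  have hWne : M.eRk W ≠ ⊤ := ((M.eRk_le_encard W).trans_lt hWfin.encard_lt_top).ne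
  obtain ⟨r, hr⟩ := ENat.ne_top_iff_exists.1 hWne
  have hWr : W.ncard = r + 4 := by
    have h := hWk
    rw [← hr, ← hWfin.cast_ncard_eq] at h
    exact_mod_cast h
  have hr4 : 4 ≤ r := by
    by_contra hlt
    push Not at hlt
    have h3 : M.eRk W ≤ 3 := by rw [← hr]; exact_mod_cast (by omega : r ≤ 3)
    have h6' := ncard_le_six_of_eRk_le_three_of_free M hfree hW h3
    have h2 : M.eRk W ≤ 2 := by rw [← hr]; exact_mod_cast (by omega : r ≤ 2)
    have h3' := S2.ncard_le_three_of_eRk_le_two M hs hC1 hW h2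
    omega
  rcases (show W.ncard = 9 ∨ W.ncard = 8 by omega) with hw | hw
  · exact c025_eleven_eight_k2_nu_four_simple_nine M hR hn hfree hV11 ⟨W, hW, hw, hWk⟩
  · exact c025_eleven_eight_k2_nu_four_simple_eight M hR hn hfree hV11 ⟨W, hW, hw, hWk⟩

end ThmN

end PercRepro
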